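/-
Copyright (c) 2026 the pub-hodgecm-mathlib formalisation cell (harness21).  Prover seat hodgecm-mathlib-A-p03 (g24); LEAD F0P3a-plan (g9) WORD T8-41 «(F4)–(F8) PEN 1»,
LAYER C glue, 2026-09-01.
-/
import Mathlib.Algebra.BigOperators.Finprod
import Mathlib.Tactic
import HarnessLib

/-!
# Cor. 9's re-indexing `j = 2i + θ̄`: `∑ᶠ_i F(2i + θ̄) = ∑ᶠ_j [j ≡ θ̄ (2)] F(j)`

Topic `NumberTheory/Rogawski1990` (road «D-N7-inert», LAYER C glue); namespace `Literature.NumberTheory.Rogawski1990.Flicker1998`.  THEOREMS ONLY, Mathlib-only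
imports; kernel lane.

Flicker's Cor. 9 (p. 85) sums «over `j ≥ 0` with `j − θ̄` even»; B-p04's ★ `natCard_fixedPoints_centralizer_eq_finsum` produces `∑ᶠ i, w(r_i)·#(i)` indexed by
the radial exponent `i` (`j = 2i + θ̄`), while F0P3b-p01's ★ bridge `finsum_natCast_eq_phiOne` ∕ `…_eq_phiZero` consumes `∑ᶠ j, (if j % 2 = θ̄ then … else 0)`.
This file is the one-line dictionary between the two (**`finsum_comp_two_mul_add_eq_finsum_ite`**), plus the `θ̄ = 0, 1` specialisations.
HONEST LABEL: pure bookkeeping; HC_CM is proved only modulo the printed citations until rung 0 closes.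

## References
* [Flicker1998UnitaryFL] Y. Z. Flicker, *Elementary proof of the fundamental lemma for a unitary group*, Canad. J. Math. 50 (1998), 74–98: Cor. 9 p. 85.
-/

set_option autoImplicit false

namespace Literature.NumberTheory.Rogawski1990

namespace Flicker1998

/-- `j ↦` «`j = 2i + θ̄` for some `i`» is `j % 2 = θ̄` when `θ̄ ≤ 1`. [cite: Flicker1998UnitaryFL, Cor. 9 p. 85] -/
theorem mem_range_two_mul_add_iff {θbar : ℕ} (hθ : θbar ≤ 1) (j : ℕ) :
    j ∈ Set.range (fun i : ℕ => 2 * i + θbar) ↔ j % 2 = θbar := by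
  simp only [Set.mem_range]
  constructor
  · rintro ⟨i, rfl⟩; omega
  · intro h; exact ⟨j / 2, by omega⟩

/-- **Cor. 9's re-indexing**: `∑ᶠ i, F (2i + θ̄) = ∑ᶠ j, (if j % 2 = θ̄ then F j else 0)` (`θ̄ ≤ 1`; no finiteness needed — both sides are `0` on infinite
support simultaneously). [cite: Flicker1998UnitaryFL, Cor. 9 p. 85] -/
theorem finsum_comp_two_mul_add_eq_finsum_ite {M : Type*} [AddCommMonoid M] (F : ℕ → M) {θbar : ℕ} (hθ : θbar ≤ 1) :
    ∑ᶠ i, F (2 * i + θbar) = ∑ᶠ j, (if j % 2 = θbar then F j else 0) := by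
  classical
  have hinj : Function.Injective (fun i : ℕ => 2 * i + θbar) := fun a b h => by simpa using h
  rw [← finsum_mem_range hinj, finsum_mem_def]
  refine finsum_congr fun j => ?_
  simp only [Set.indicator_apply, mem_range_two_mul_add_iff hθ]

/-- `θ̄ = 1` (Flicker's `θ = π`): `∑ᶠ i, F (2i + 1) = ∑ᶠ j, (if j % 2 = 1 then F j else 0)`. [cite: Flicker1998UnitaryFL, Cor. 9 p. 85] -/
theorem finsum_comp_two_mul_add_one_eq_finsum_ite {M : Type*} [AddCommMonoid M] (F : ℕ → M) :
    ∑ᶠ i, F (2 * i + 1) = ∑ᶠ j, (if j % 2 = 1 then F j else 0) :=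
  finsum_comp_two_mul_add_eq_finsum_ite F le_rfl

/-- `θ̄ = 0` (Flicker's `θ = 1`): `∑ᶠ i, F (2i) = ∑ᶠ j, (if j % 2 = 0 then F j else 0)`. [cite: Flicker1998UnitaryFL, Cor. 9 p. 85] -/
theorem finsum_comp_two_mul_eq_finsum_ite {M : Type*} [AddCommMonoid M] (F : ℕ → M) :
    ∑ᶠ i, F (2 * i) = ∑ᶠ j, (if j % 2 = 0 then F j else 0) := by
  simpa using finsum_comp_two_mul_add_eq_finsum_ite F (Nat.zero_le 1)

end Flicker1998

end Literature.NumberTheory.Rogawski1990
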